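import Summits.ResolutionOfSingularities.ResolutionOfSingularities.Theorems.DeltaCutStellarGuardWild
import Literature.AlgebraicGeometry.Resolution.HasseSchmidtDiffEqDiffOp

/-!
# StellarCut N23a — «Hasse»: the HIGHER-ORDER (EXACT) GUARD — symbolic-power lowering for Grothendieck differential operators,
# and the order-`< n` bound for the reduced fibre form at a NON-RESONANT tight face (lens-6 «barrier-complement carving», g37 door 4)

The first-order guards of T10a (`DeltaCutStellarGuard`) / T15 (`DeltaCutStellarGuardWild`) bound the order of the reduced fibre
form `G` of a hypersurface-shape datum by `1` through a DERIVATION `D` with `D G ∉ 𝔮` — dead at a TIGHT face all of whose labels are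
divisible by the residue characteristic (`G = 1 + T_z²T_w² = (1 + T_zT_w)²` over `𝔽₂`: every derivation kills `G`, and `G` has
order `2` at `T_z = T_w = 1`; N23e §TightFace).  THIS FILE replaces the derivation by a DIFFERENTIAL OPERATOR OF ORDER `< n`
(Grothendieck, EGA IV₄ 16.8; the Hasse–Schmidt derivatives `D^{(α)}` of `Literature…HasseSchmidtDerivatives` /
`…HasseSchmidtDiffEqDiffOp`, BY NAME) and the bound `1` by the EXACT bound `n = M.mult`:

* §Lower — `exists_mul_apply_mem_pow_sub`: **symbolic-power lowering** — `D ∈ Diff^{≤ n}`, `s ∉ 𝔮`, `s·f ∈ 𝔮^m ⇒ ∃ s' ∉ 𝔮,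
  s'·D f ∈ 𝔮^{m−n}` (induction on the order through `[D, s]`, over `IsDiffOpLE.apply_mem_pow_sub`); `exists_mul_mem_pow_of_algebraMap_mem`
  (`f/1 ∈ 𝔪_{A_𝔮}^m ⇒ ∃ s ∉ 𝔮, s·f ∈ 𝔮^m`); ★ `algebraMap_notMem_maximalIdeal_pow_of_isDiffOpLE` — **THE HIGHER-ORDER GUARD
  PRINCIPLE**: an operator of order `n < N` with `D g ∉ 𝔮` certifies `g/1 ∉ 𝔪_{A_𝔮}^N` (T10a's derivation guard is `n = 1, N = 2`:
  closing `example`); `algebraMap_notMem_maximalIdeal_pow_of_notMem`.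
* §Hasse — values of `D^{(d − d_{l}e_{l})}` / `D^{(d)}` on `1`, `T_hᴺ`, `c·T^d` (over `hasseDeriv_monomial`, `hasseDeriv_apply_X_pow`);
  the EXACT polynomial guards `algebraMap_one_add_monomial_notMem_pow` (`H`-chart: `1 + c·T^d`, `c` a unit, two positive exponents,
  `|d| ≤ N ⇒ ∉ 𝔪_𝔮ᴺ` at EVERY prime), `algebraMap_X_pow_add_monomial_notMem_pow_of_degree_lt` / `_of_two` (`D_j`-charts:
  `T_hᴺ + c·T^d`, `T_h ∉ 𝔮`).  NO hypothesis on the characteristic and NONE on the residues of the exponents — only `d_l < N`.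
* §Fibre — `fibreForm_notMem_pow_of_mem_maximalIdeal` (heavy, any `N ≥ 1`), `fibreForm_notMem_pow_of_exponents_lt` (cofactor a unit,
  EVERY coordinate of `b` `< n = deg b`), ★ `fibreForm_notMem_pow'` — the `hg`-input of the near-point bound (T10c) WITH `e := n` under
  the EXACT dichotomy `a ∈ 𝔪 ∨ ∀ l, b l < n`.

0 sorry; axioms standard. [new] [cite: EGAIV4, Prop. 16.8.8 and Thm. 16.11.2] [cite: CossartPiltant2008, proof of Prop. 4.2 (a)]
-/

namespace Summit.ResolutionOfSingularities.ResolutionOfSingularities.Theorems.DeltaCutClasses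

open IsLocalRing MvPolynomial
open Literature.AlgebraicGeometry.Resolution

/-! ### §Lower — symbolic-power lowering and the higher-order guard principle -/

section Lower

variable {R A : Type*} [CommSemiring R] [CommRing A] [Algebra R A]

/-- **Symbolic-power lowering.**  A differential operator `D` of order `≤ n` (Grothendieck) lowers SYMBOLIC `𝔮`-adic order by at
most `n`: if `s·f ∈ 𝔮^m` with `s ∉ 𝔮` then `s'·D f ∈ 𝔮^{m−n}` for some `s' ∉ 𝔮` — induction on `n` through
`D (s f) = [D, s] f + s·D f`, `[D, s]` of order `≤ n − 1`, and `IsDiffOpLE.apply_mem_pow_sub` for the ordinary powers.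
[new] [cite: EGAIV4, Prop. 16.8.8 (b)] -/
theorem exists_mul_apply_mem_pow_sub (𝔮 : Ideal A) [𝔮.IsPrime] :
    ∀ (n : ℕ) {D : A →ₗ[R] A}, IsDiffOpLE R n D → ∀ (m : ℕ) {f s : A}, s ∉ 𝔮 → s * f ∈ 𝔮 ^ m →
      ∃ s' : A, s' ∉ 𝔮 ∧ s' * D f ∈ 𝔮 ^ (m - n)
  | 0, D, hD, m, f, s, hs, hsf => by
    refine ⟨s, hs, ?_⟩
    have h0 : D (s * f) - s * D f = 0 := by
      have h := LinearMap.congr_fun (hD s) f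
      rwa [commMul_apply, LinearMap.zero_apply] at h
    rw [Nat.sub_zero, ← sub_eq_zero.mp h0]
    simpa only [Nat.sub_zero] using hD.apply_mem_pow_sub 𝔮 m hsf
  | n + 1, D, hD, m, f, s, hs, hsf => by
    obtain ⟨s'', hs'', hmem⟩ := exists_mul_apply_mem_pow_sub 𝔮 n (hD s) m hs hsf
    refine ⟨s'' * s, fun h => (Ideal.IsPrime.mem_or_mem ‹_› h).elim hs'' hs, ?_⟩
    rw [commMul_apply] at hmem
    have h1 : s'' * D (s * f) ∈ 𝔮 ^ (m - (n + 1)) := Ideal.mul_mem_left _ _ (hD.apply_mem_pow_sub 𝔮 m hsf)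
    have h2 : s'' * (D (s * f) - s * D f) ∈ 𝔮 ^ (m - (n + 1)) := Ideal.pow_le_pow_right (by omega) hmem
    have h3 := Ideal.sub_mem _ h1 h2
    rwa [← mul_sub, sub_sub_cancel, ← mul_assoc] at h3

/-- **Symbolic membership from the localization**: `f/1 ∈ 𝔪_Lᵐ` (`L` a localization of `A` at the prime `𝔮`) gives `s·f ∈ 𝔮^m`
for some `s ∉ 𝔮`. [folklore] -/
theorem exists_mul_mem_pow_of_algebraMap_mem (𝔮 : Ideal A) [𝔮.IsPrime] (L : Type*) [CommRing L] [IsLocalRing L]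
    [Algebra A L] [IsLocalization.AtPrime L 𝔮] {f : A} {m : ℕ} (hf : algebraMap A L f ∈ maximalIdeal L ^ m) :
    ∃ s : A, s ∉ 𝔮 ∧ s * f ∈ 𝔮 ^ m := by
  rw [← IsLocalization.AtPrime.map_eq_maximalIdeal 𝔮 L, ← Ideal.map_pow,
    IsLocalization.mem_map_algebraMap_iff 𝔮.primeCompl L] at hf
  obtain ⟨x, hx⟩ := hf
  rw [← map_mul] at hx
  obtain ⟨c, hc⟩ := (IsLocalization.eq_iff_exists 𝔮.primeCompl L).mp hx
  refine ⟨c * x.2, fun hmem => (Ideal.IsPrime.mem_or_mem ‹_› hmem).elim c.2 x.2.2, ?_⟩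
  have h : (c : A) * x.2 * f = c * (f * x.2) := by ring
  rw [h, hc]
  exact Ideal.mul_mem_left _ _ x.1.2

/-- ★ **THE HIGHER-ORDER GUARD PRINCIPLE.**  If a differential operator `D` of order `≤ n < N` has `D g ∉ 𝔮` (`𝔮` prime), then
`g/1 ∉ 𝔪_Lᴺ` in any localization `L` of `A` at `𝔮` — the symbolic `𝔮`-adic order of `g` is `< N`.  No hypothesis on the residue
field.  (T10a's `algebraMap_notMem_maximalIdeal_sq_of_derivation_apply_notMem` is the case `n = 1`, `N = 2`: the closing `example`.)
[new] [cite: EGAIV4, Prop. 16.8.8] -/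
theorem algebraMap_notMem_maximalIdeal_pow_of_isDiffOpLE (𝔮 : Ideal A) [𝔮.IsPrime] (L : Type*) [CommRing L]
    [IsLocalRing L] [Algebra A L] [IsLocalization.AtPrime L 𝔮] {n N : ℕ} (hnN : n < N) {D : A →ₗ[R] A}
    (hD : IsDiffOpLE R n D) {g : A} (hDg : D g ∉ 𝔮) : algebraMap A L g ∉ maximalIdeal L ^ N := by
  intro hmem
  obtain ⟨s, hs, hsg⟩ := exists_mul_mem_pow_of_algebraMap_mem 𝔮 L hmem
  obtain ⟨s', hs', h⟩ := exists_mul_apply_mem_pow_sub 𝔮 n hD N hs hsg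
  exact (Ideal.IsPrime.mem_or_mem ‹_› (Ideal.pow_le_self (by omega) h)).elim hs' hDg

/-- Off `V(g)` there is nothing to guard: `g ∉ 𝔮` makes `g/1` a unit of `L`, so `g/1 ∉ 𝔪_Lᴺ` for `N ≠ 0`. [folklore] -/
theorem algebraMap_notMem_maximalIdeal_pow_of_notMem (𝔮 : Ideal A) [𝔮.IsPrime] (L : Type*) [CommRing L] [IsLocalRing L]
    [Algebra A L] [IsLocalization.AtPrime L 𝔮] {g : A} (hg : g ∉ 𝔮) {N : ℕ} (hN : N ≠ 0) :
    algebraMap A L g ∉ maximalIdeal L ^ N := fun hmem =>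
  hg ((IsLocalization.AtPrime.to_map_mem_maximal_iff L 𝔮 g).mp (Ideal.pow_le_self hN hmem))

-- T10a's first-order derivation guard IS the case `n = 1`, `N = 2` (a derivation is an operator of order `≤ 1`).
example {S : Type*} [CommRing S] [Algebra S A] (δ : Derivation S A A) (𝔮 : Ideal A) [𝔮.IsPrime] (L : Type*) [CommRing L]
    [IsLocalRing L] [Algebra A L] [IsLocalization.AtPrime L 𝔮] {g : A} (hδ : δ g ∉ 𝔮) :
    algebraMap A L g ∉ maximalIdeal L ^ 2 :=
  algebraMap_notMem_maximalIdeal_pow_of_isDiffOpLE 𝔮 L one_lt_two (Derivation.isDiffOpLE_one δ) hδ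

end Lower

/-! ### §Hasse — the Hasse–Schmidt derivatives on the fibre polynomials, and the EXACT polynomial guards -/

section Hasse

variable {κ : Type*} [CommRing κ] {σ : Type*}

-- WRITER NOTE (g16): PIN e4fdd780 declared `theorem degree_erase_add_apply` (general `σ`, two-line proof) here; the gate's
-- `dedup.landed` pre-flight equates it with the landed `NoJump.degree_erase_add` (NoJumpOrderQ), whose statement however carries
-- `[Fintype σ] [DecidableEq σ]` and so cannot be cited at the two instance-free use sites below — the proof is inlined there instead.
/-- degree bookkeeping on a chart: `|b|_{l ≠ j}| + b_j = |b|`. [folklore] -/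
theorem degree_subtypeDomain_add {k : ℕ} (b : Fin k →₀ ℕ) (j : Fin k) :
    (b.subtypeDomain fun l => l ≠ j).degree + b j = b.degree := by
  classical
  simp only [Finsupp.degree_eq_sum, Finsupp.subtypeDomain_apply]
  rw [← Finset.sum_subtype (Finset.univ.erase j) (fun l => by simp) (b : Fin k → ℕ),
    Finset.sum_erase_add _ _ (Finset.mem_univ j)]

/-- **`D^{(d − d_l e_l)}(c·T^d) = c·T_l^{d_l}`** (all the binomials are `C(d_i, d_i) = 1`). [cite: EGAIV4, Thm. 16.11.2 (16.11.2.1)] -/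
theorem hasseDeriv_erase_monomial (d : σ →₀ ℕ) (l : σ) (c : κ) :
    hasseDeriv κ (d.erase l) (monomial d c) = C c * X l ^ d l := by
  classical
  have hsub : d - d.erase l = Finsupp.single l (d l) := by
    ext i
    rw [Finsupp.tsub_apply, Finsupp.single_apply]
    by_cases hi : l = i
    · subst hi
      rw [Finsupp.erase_same, if_pos rfl, Nat.sub_zero]
    · rw [Finsupp.erase_ne (Ne.symm hi), if_neg hi, Nat.sub_self]
  rw [hasseDeriv_monomial, Finset.prod_eq_one fun i hi => ?_, Nat.cast_one, one_mul, hsub, C_mul_X_pow_eq_monomial]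
  rw [Finsupp.support_erase] at hi
  rw [Finsupp.erase_ne (Finset.ne_of_mem_erase hi), Nat.choose_self]

/-- `D^{(α)}(1) = 0` for `α ≠ 0`. [cite: EGAIV4, Thm. 16.11.2 (16.11.2.1)] -/
theorem hasseDeriv_one_eq_zero {α : σ →₀ ℕ} (hα : α ≠ 0) : hasseDeriv κ α (1 : MvPolynomial σ κ) = 0 := by
  classical
  rw [← C_1, C_apply]
  refine hasseDeriv_monomial_eq_zero_of_not_le κ (fun h => hα (Finsupp.ext fun i => ?_)) 1
  exact Nat.eq_zero_of_le_zero (Finsupp.le_def.mp h i)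

/-- `D^{(α)}(T_hᴺ) = 0` as soon as `α` involves a variable `T_l`, `l ≠ h`. [cite: EGAIV4, Thm. 16.11.2 (16.11.2.1)] -/
theorem hasseDeriv_X_pow_eq_zero {α : σ →₀ ℕ} {h l : σ} (hl : l ≠ h) (hαl : α l ≠ 0) (N : ℕ) :
    hasseDeriv κ α (X h ^ N : MvPolynomial σ κ) = 0 := by
  classical
  rw [hasseDeriv_apply_X_pow, if_neg]
  intro hα
  apply hαl
  rw [hα, Finsupp.single_apply, if_neg fun e => hl e.symm]

/-- `c·T_l^m ∉ 𝔮` for `c` a unit and `T_l ∉ 𝔮` (`𝔮` prime). [folklore] -/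
theorem C_mul_X_pow_notMem {c : κ} (hc : IsUnit c) (𝔮 : Ideal (MvPolynomial σ κ)) [𝔮.IsPrime] {l : σ} (hX : X l ∉ 𝔮)
    (m : ℕ) : C c * X l ^ m ∉ 𝔮 := fun hmem =>
  (Ideal.IsPrime.mem_or_mem ‹_› hmem).elim (fun hC => Ideal.IsPrime.ne_top ‹_› (𝔮.eq_top_of_isUnit_mem hC (hc.map C)))
    fun hXm => hX (Ideal.IsPrime.mem_of_pow_mem ‹_› _ hXm)

/-- `T_l ∈ 𝔮 ⇒ c·T^d ∈ 𝔮` when `d_l ≠ 0`. [folklore] -/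
theorem monomial_mem_of_X_mem (d : σ →₀ ℕ) (c : κ) {l : σ} (hl : d l ≠ 0) (𝔮 : Ideal (MvPolynomial σ κ)) (hX : X l ∈ 𝔮) :
    monomial d c ∈ 𝔮 := by
  obtain ⟨q, hq⟩ : (X l : MvPolynomial σ κ) ∣ monomial d c := X_dvd_monomial.mpr (Or.inr hl)
  rw [hq]
  exact 𝔮.mul_mem_right _ hX

/-- ★ **EXACT `H`-chart guard.**  `g = 1 + c·T^d` with `c` a unit and TWO positive exponents `d_{l₀}, d_{l₁}` (`l₀ ≠ l₁`): at EVERY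
prime `𝔮` of `κ[T]`, `g/1 ∉ 𝔪_𝔮ᴺ` for any `N ≥ |d|` — if `T_{l₀} ∈ 𝔮` then `g ≡ 1`, a unit; else the Hasse derivative
`D^{(d − d_{l₀}e_{l₀})}`, of order `|d| − d_{l₀} < N`, takes `g` to `c·T_{l₀}^{d_{l₀}} ∉ 𝔮` (§Lower).  No hypothesis on the
characteristic, none on the residues of the exponents. [new] [cite: EGAIV4, Thm. 16.11.2] [cite: CossartPiltant2008, proof of Prop. 4.2 (a)] -/
theorem algebraMap_one_add_monomial_notMem_pow (d : σ →₀ ℕ) {c : κ} (hc : IsUnit c) {l₀ l₁ : σ} (hne : l₀ ≠ l₁)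
    (h₀ : d l₀ ≠ 0) (h₁ : d l₁ ≠ 0) {N : ℕ} (hN : d.degree ≤ N) (𝔮 : Ideal (MvPolynomial σ κ)) [𝔮.IsPrime]
    (L : Type*) [CommRing L] [IsLocalRing L] [Algebra (MvPolynomial σ κ) L] [IsLocalization.AtPrime L 𝔮] :
    algebraMap (MvPolynomial σ κ) L (1 + monomial d c) ∉ maximalIdeal L ^ N := by
  classical
  have hdeg : (d.erase l₀).degree + d l₀ = d.degree := by
    conv_rhs => rw [← Finsupp.erase_add_single l₀ d]
    rw [map_add, Finsupp.degree_single]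
  by_cases hX : X l₀ ∈ 𝔮
  · refine algebraMap_notMem_maximalIdeal_pow_of_notMem 𝔮 L (fun hg => ?_) (by omega)
    have h1 := 𝔮.sub_mem hg (monomial_mem_of_X_mem d c h₀ 𝔮 hX)
    rw [add_sub_cancel_right] at h1
    exact Ideal.IsPrime.ne_top ‹_› ((Ideal.eq_top_iff_one 𝔮).mpr h1)
  · have hα : d.erase l₀ ≠ 0 := fun h0 => h₁ (by
      have h := DFunLike.congr_fun h0 l₁
      rwa [Finsupp.erase_ne hne.symm, Finsupp.zero_apply] at h)
    refine algebraMap_notMem_maximalIdeal_pow_of_isDiffOpLE 𝔮 L (n := (d.erase l₀).degree) (by omega)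
      (isDiffOpLE_hasseDeriv κ _ (d.erase l₀) le_rfl) ?_
    rw [map_add, hasseDeriv_one_eq_zero hα, zero_add, hasseDeriv_erase_monomial]
    exact C_mul_X_pow_notMem hc 𝔮 hX _

/-- ★ **EXACT `D_j`-chart guard, light monomial.**  `g = T_hᴺ + c·T^d` with `c` a unit, ONE positive exponent `d_{l₀}`, `l₀ ≠ h`,
and `|d| < N`: `g/1 ∉ 𝔪_𝔮ᴺ` at EVERY prime — `D^{(d)}`, of order `|d| < N`, takes `g` to the unit `c`. [new] [cite: EGAIV4, Thm. 16.11.2] -/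
theorem algebraMap_X_pow_add_monomial_notMem_pow_of_degree_lt (h : σ) (d : σ →₀ ℕ) {c : κ} (hc : IsUnit c) {l₀ : σ}
    (hl₀ : l₀ ≠ h) (h₀ : d l₀ ≠ 0) {N : ℕ} (hN : d.degree < N) (𝔮 : Ideal (MvPolynomial σ κ)) [𝔮.IsPrime]
    (L : Type*) [CommRing L] [IsLocalRing L] [Algebra (MvPolynomial σ κ) L] [IsLocalization.AtPrime L 𝔮] :
    algebraMap (MvPolynomial σ κ) L (X h ^ N + monomial d c) ∉ maximalIdeal L ^ N := by
  classical
  refine algebraMap_notMem_maximalIdeal_pow_of_isDiffOpLE 𝔮 L hN (isDiffOpLE_hasseDeriv κ _ d le_rfl) ?_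
  rw [map_add, hasseDeriv_X_pow_eq_zero hl₀ h₀, zero_add, hasseDeriv_monomial_self]
  exact fun hC => Ideal.IsPrime.ne_top ‹_› (𝔮.eq_top_of_isUnit_mem hC (hc.map C))

/-- ★ **EXACT `D_j`-chart guard, two exponents.**  `g = T_hᴺ + c·T^d` with `c` a unit, two positive exponents `d_{l₀}, d_{l₁}`
(`l₀ ≠ l₁`, `l₁ ≠ h`), `|d| ≤ N`, at a prime `𝔮 ∌ T_h` (a point OFF the strict transform `H'`): `g/1 ∉ 𝔪_𝔮ᴺ` — if `T_{l₀} ∈ 𝔮` then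
`g ≡ T_hᴺ ∉ 𝔮`; else `D^{(d − d_{l₀}e_{l₀})}` takes `g` to `c·T_{l₀}^{d_{l₀}} ∉ 𝔮`. [new] [cite: EGAIV4, Thm. 16.11.2]
[cite: CossartPiltant2008, proof of Prop. 4.2 (a)] -/
theorem algebraMap_X_pow_add_monomial_notMem_pow_of_two (h : σ) (d : σ →₀ ℕ) {c : κ} (hc : IsUnit c) {l₀ l₁ : σ}
    (hne : l₀ ≠ l₁) (hl₁ : l₁ ≠ h) (h₀ : d l₀ ≠ 0) (h₁ : d l₁ ≠ 0) {N : ℕ} (hN : d.degree ≤ N)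
    (𝔮 : Ideal (MvPolynomial σ κ)) [𝔮.IsPrime] (hh : X h ∉ 𝔮)
    (L : Type*) [CommRing L] [IsLocalRing L] [Algebra (MvPolynomial σ κ) L] [IsLocalization.AtPrime L 𝔮] :
    algebraMap (MvPolynomial σ κ) L (X h ^ N + monomial d c) ∉ maximalIdeal L ^ N := by
  classical
  have hdeg : (d.erase l₀).degree + d l₀ = d.degree := by
    conv_rhs => rw [← Finsupp.erase_add_single l₀ d]
    rw [map_add, Finsupp.degree_single]
  by_cases hX : X l₀ ∈ 𝔮
  · refine algebraMap_notMem_maximalIdeal_pow_of_notMem 𝔮 L (fun hg => hh ?_) (by omega)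
    have h1 := 𝔮.sub_mem hg (monomial_mem_of_X_mem d c h₀ 𝔮 hX)
    rw [add_sub_cancel_right] at h1
    exact Ideal.IsPrime.mem_of_pow_mem ‹_› _ h1
  · have hα : (d.erase l₀) l₁ ≠ 0 := by rwa [Finsupp.erase_ne hne.symm]
    refine algebraMap_notMem_maximalIdeal_pow_of_isDiffOpLE 𝔮 L (n := (d.erase l₀).degree) (by omega)
      (isDiffOpLE_hasseDeriv κ _ (d.erase l₀) le_rfl) ?_
    rw [map_add, hasseDeriv_X_pow_eq_zero hl₁ hα, zero_add, hasseDeriv_erase_monomial]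
    exact C_mul_X_pow_notMem hc 𝔮 hX _

end Hasse

/-! ### §Fibre — the reduced dehomogenised fibre form has order `< n` on every chart: HEAVY or NON-RESONANT TIGHT -/

section Fibre

variable {R : Type*} [CommRing R] [IsLocalRing R] {k n : ℕ}

set_option maxHeartbeats 800000 in
/-- **HEAVY rounds, any exponent** (`a ∈ 𝔪`): the reduced dehomogenised form of `X_{l_H}ⁿ + a·X^b` is `X_{l_H}ⁿ` (resp. `1` on the
`H`-chart), which lies in no prime avoiding `X_{l_H}`: `∉ 𝔪_𝔮ᴺ` for every `N ≥ 1` (T15's `_sq_` version with `2 ↦ N`). [folklore] -/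
theorem fibreForm_notMem_pow_of_mem_maximalIdeal (lH : Fin k) (b : Fin k →₀ ℕ) {a : R} (ha : a ∈ maximalIdeal R) {N : ℕ}
    (hN : N ≠ 0) (j : Fin k) (𝔮 : Ideal (MvPolynomial {l : Fin k // l ≠ j} (R ⧸ maximalIdeal R))) [𝔮.IsPrime]
    (h𝔮 : ∀ l : {l : Fin k // l ≠ j}, l.1 ∈ ({lH} : Set (Fin k)) →
      (MvPolynomial.X l : MvPolynomial {l : Fin k // l ≠ j} (R ⧸ maximalIdeal R)) ∉ 𝔮) :
    algebraMap _ (Localization.AtPrime 𝔮) (MvPolynomial.map (Ideal.Quotient.mk (maximalIdeal R))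
      (dehomogenize j (MvPolynomial.X lH ^ n + MvPolynomial.monomial b a))) ∉ maximalIdeal (Localization.AtPrime 𝔮) ^ N := by
  classical
  have hF : MvPolynomial.map (Ideal.Quotient.mk (maximalIdeal R))
      (dehomogenize j (MvPolynomial.X lH ^ n + MvPolynomial.monomial b a)) = killVar j lH ^ n := by
    rw [map_dehomogenize, map_add, map_pow, MvPolynomial.map_X, MvPolynomial.map_monomial,
      Ideal.Quotient.eq_zero_iff_mem.mpr ha, map_zero, add_zero, map_pow, dehomogenize_X]
  rw [hF]
  refine algebraMap_notMem_maximalIdeal_pow_of_notMem 𝔮 (Localization.AtPrime 𝔮) (fun hmem => ?_) hN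
  by_cases hj : lH = j
  · subst hj
    rw [killVar_self, one_pow] at hmem
    exact Ideal.IsPrime.ne_top ‹_› ((Ideal.eq_top_iff_one 𝔮).mpr hmem)
  · rw [killVar_of_ne j hj] at hmem
    exact h𝔮 ⟨lH, hj⟩ (Set.mem_singleton lH) (Ideal.IsPrime.mem_of_pow_mem ‹_› _ hmem)

/-- the reduced dehomogenised fibre form on the chart `j`: `(killVar j l_H)ⁿ + ā·X^{b|_{l ≠ j}}`. [folklore] -/
theorem map_dehomogenize_fibreForm (lH : Fin k) (b : Fin k →₀ ℕ) (a : R) (j : Fin k) :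
    MvPolynomial.map (Ideal.Quotient.mk (maximalIdeal R)) (dehomogenize j (MvPolynomial.X lH ^ n + MvPolynomial.monomial b a)) =
      killVar j lH ^ n + MvPolynomial.monomial (b.subtypeDomain fun l => l ≠ j) (Ideal.Quotient.mk (maximalIdeal R) a) := by
  classical
  rw [map_dehomogenize, map_add, map_pow, MvPolynomial.map_X, MvPolynomial.map_monomial, map_add, map_pow, dehomogenize_X,
    dehomogenize_monomial]

/-- an exponent vector all of whose coordinates are `< Σ_l b l` has two distinct positive coordinates. [folklore] -/
theorem exists_two_ne_zero_of_forall_lt (b : Fin k →₀ ℕ) (hbn : b.degree = n) (hn : n ≠ 0) (hb : ∀ l, b l < n) :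
    ∃ l₀ l₁, l₁ ≠ l₀ ∧ b l₀ ≠ 0 ∧ b l₁ ≠ 0 := by
  classical
  obtain ⟨l₀, hl₀⟩ : ∃ l, b l ≠ 0 := by
    by_contra h0
    push Not at h0
    have hdeg : b.degree = 0 := by
      rw [Finsupp.degree_eq_sum]
      exact Finset.sum_eq_zero fun l _ => h0 l
    omega
  obtain ⟨l₁, hl₁₀, hl₁⟩ : ∃ l, l ≠ l₀ ∧ b l ≠ 0 := by
    by_contra h1
    push Not at h1
    have hsum : b.degree = b l₀ := by
      rw [Finsupp.degree_eq_sum, ← Finset.add_sum_erase _ _ (Finset.mem_univ l₀),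
        Finset.sum_eq_zero fun l hl => h1 l (Finset.ne_of_mem_erase hl), add_zero]
    have := hb l₀
    omega
  exact ⟨l₀, l₁, hl₁₀, hl₀, hl₁⟩

set_option maxHeartbeats 800000 in
/-- ★ **NON-RESONANT TIGHT rounds** (cofactor `a ∉ 𝔪`, EVERY coordinate of `b` `< n = deg b`, `b l_H = 0`): the reduced dehomogenised
form of `X_{l_H}ⁿ + a·X^b` has order `< n` at every prime avoiding `X_{l_H}`, on every chart `j` — `b` has two positive coordinates
`l₀ ≠ l₁` (each `< n = Σ b`); on the `H`-chart the exact guard `algebraMap_one_add_monomial_notMem_pow`; on a `D_j`-chart with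
`b_j = 0` the two-exponent guard, with `b_j > 0` (so `|b|_{l ≠ j}| < n`) the light-monomial guard.  THIS is the guard that survives
`p ∣ b_l` for all `l` (g34's face `(z : 2, w : 2)` at `n = 4` in characteristic `2`). [new] [cite: EGAIV4, Thm. 16.11.2]
[cite: CossartPiltant2008, proof of Prop. 4.2 (a)] -/
theorem fibreForm_notMem_pow_of_exponents_lt (lH : Fin k) (b : Fin k →₀ ℕ) (hblH : b lH = 0) (hbn : b.degree = n)
    (hb : ∀ l, b l < n) {a : R} (ha : a ∉ maximalIdeal R) (j : Fin k)
    (𝔮 : Ideal (MvPolynomial {l : Fin k // l ≠ j} (R ⧸ maximalIdeal R))) [𝔮.IsPrime]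
    (h𝔮 : ∀ l : {l : Fin k // l ≠ j}, l.1 ∈ ({lH} : Set (Fin k)) →
      (MvPolynomial.X l : MvPolynomial {l : Fin k // l ≠ j} (R ⧸ maximalIdeal R)) ∉ 𝔮) :
    algebraMap _ (Localization.AtPrime 𝔮) (MvPolynomial.map (Ideal.Quotient.mk (maximalIdeal R))
      (dehomogenize j (MvPolynomial.X lH ^ n + MvPolynomial.monomial b a))) ∉ maximalIdeal (Localization.AtPrime 𝔮) ^ n := by
  classical
  have hn : n ≠ 0 := by have := hb lH; omega
  obtain ⟨l₀, l₁, hl₁₀, hl₀, hl₁⟩ := exists_two_ne_zero_of_forall_lt b hbn hn hb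
  have hl₀H : l₀ ≠ lH := fun h => hl₀ (by rw [h]; exact hblH)
  have hl₁H : l₁ ≠ lH := fun h => hl₁ (by rw [h]; exact hblH)
  -- the cofactor is a unit of the residue field
  have hau : IsUnit a := by
    by_contra hu
    exact ha ((IsLocalRing.mem_maximalIdeal a).mpr (mem_nonunits_iff.mpr hu))
  have hc : IsUnit (Ideal.Quotient.mk (maximalIdeal R) a) := hau.map _
  rw [map_dehomogenize_fibreForm]
  have hdegle : (b.subtypeDomain fun l => l ≠ j).degree ≤ n := (degree_subtypeDomain_le j b).trans hbn.le
  by_cases hj : lH = j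
  · -- the `H`-chart: `1 + ā X^b`, two positive exponents off `l_H`
    subst hj
    rw [killVar_self, one_pow]
    have hne' : (⟨l₀, hl₀H⟩ : {l : Fin k // l ≠ lH}) ≠ ⟨l₁, hl₁H⟩ := fun h => hl₁₀ (congrArg Subtype.val h).symm
    have h₀' : (b.subtypeDomain fun l => l ≠ lH) ⟨l₀, hl₀H⟩ ≠ 0 := by rw [Finsupp.subtypeDomain_apply]; exact hl₀
    have h₁' : (b.subtypeDomain fun l => l ≠ lH) ⟨l₁, hl₁H⟩ ≠ 0 := by rw [Finsupp.subtypeDomain_apply]; exact hl₁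
    exact algebraMap_one_add_monomial_notMem_pow _ hc hne' h₀' h₁' hdegle 𝔮 (Localization.AtPrime 𝔮)
  · -- a `D_j`-chart off `V(H')`: `X_{l_H}ⁿ + ā X^b`, `X_{l_H} ∉ 𝔮`
    rw [killVar_of_ne j hj]
    have hh : (MvPolynomial.X (⟨lH, hj⟩ : {l : Fin k // l ≠ j}) :
        MvPolynomial {l : Fin k // l ≠ j} (R ⧸ maximalIdeal R)) ∉ 𝔮 := h𝔮 ⟨lH, hj⟩ (Set.mem_singleton lH)
    by_cases hbj : b j = 0
    · -- `b_j = 0`: both positive coordinates survive dehomogenisation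
      have hl₀j : l₀ ≠ j := fun h => hl₀ (by rw [h]; exact hbj)
      have hl₁j : l₁ ≠ j := fun h => hl₁ (by rw [h]; exact hbj)
      have hne' : (⟨l₀, hl₀j⟩ : {l : Fin k // l ≠ j}) ≠ ⟨l₁, hl₁j⟩ := fun h => hl₁₀ (congrArg Subtype.val h).symm
      have hl₁' : (⟨l₁, hl₁j⟩ : {l : Fin k // l ≠ j}) ≠ ⟨lH, hj⟩ := fun h => hl₁H (congrArg Subtype.val h)
      have h₀' : (b.subtypeDomain fun l => l ≠ j) ⟨l₀, hl₀j⟩ ≠ 0 := by rw [Finsupp.subtypeDomain_apply]; exact hl₀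
      have h₁' : (b.subtypeDomain fun l => l ≠ j) ⟨l₁, hl₁j⟩ ≠ 0 := by rw [Finsupp.subtypeDomain_apply]; exact hl₁
      exact algebraMap_X_pow_add_monomial_notMem_pow_of_two _ _ hc hne' hl₁' h₀' h₁' hdegle 𝔮 hh (Localization.AtPrime 𝔮)
    · -- `b_j > 0`: the dehomogenised exponent has degree `n − b_j < n`; one positive coordinate differs from `j`
      obtain ⟨l, hlj, hl⟩ : ∃ l, l ≠ j ∧ b l ≠ 0 := by
        by_cases h : l₀ = j
        · exact ⟨l₁, fun h' => hl₁₀ (h'.trans h.symm), hl₁⟩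
        · exact ⟨l₀, h, hl₀⟩
      have hlH : l ≠ lH := fun h => hl (by rw [h]; exact hblH)
      have hdeglt : (b.subtypeDomain fun l => l ≠ j).degree < n := by
        have := degree_subtypeDomain_add b j
        omega
      have hl' : (⟨l, hlj⟩ : {l : Fin k // l ≠ j}) ≠ ⟨lH, hj⟩ := fun h => hlH (congrArg Subtype.val h)
      have h₀' : (b.subtypeDomain fun l => l ≠ j) ⟨l, hlj⟩ ≠ 0 := by rw [Finsupp.subtypeDomain_apply]; exact hl
      exact algebraMap_X_pow_add_monomial_notMem_pow_of_degree_lt _ _ hc hl' h₀' hdeglt 𝔮 (Localization.AtPrime 𝔮)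

/-- ★ **THE EXACT FIBRE GUARD, HEAVY ∨ NON-RESONANT** — the `hg`-input of the near-point bound (T10c) WITH EXPONENT `e := n` for
the fibre form `X_{l_H}ⁿ + a·X^b` (`deg b = n ≠ 0`, `b l_H = 0`) under the EXACT dichotomy `a ∈ 𝔪 ∨ ∀ l, b l < n`. [new]
[cite: EGAIV4, Thm. 16.11.2] [cite: CossartPiltant2008, proof of Prop. 4.2 (a)] -/
theorem fibreForm_notMem_pow' (hn : n ≠ 0) (lH : Fin k) (b : Fin k →₀ ℕ) (hblH : b lH = 0) (hbn : b.degree = n) (a : R)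
    (hexact : a ∈ maximalIdeal R ∨ ∀ l, b l < n) (j : Fin k)
    (𝔮 : Ideal (MvPolynomial {l : Fin k // l ≠ j} (R ⧸ maximalIdeal R))) [𝔮.IsPrime]
    (h𝔮 : ∀ l : {l : Fin k // l ≠ j}, l.1 ∈ ({lH} : Set (Fin k)) →
      (MvPolynomial.X l : MvPolynomial {l : Fin k // l ≠ j} (R ⧸ maximalIdeal R)) ∉ 𝔮) :
    algebraMap _ (Localization.AtPrime 𝔮) (MvPolynomial.map (Ideal.Quotient.mk (maximalIdeal R))
      (dehomogenize j (MvPolynomial.X lH ^ n + MvPolynomial.monomial b a))) ∉ maximalIdeal (Localization.AtPrime 𝔮) ^ n := by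
  by_cases ha : a ∈ maximalIdeal R
  · exact fibreForm_notMem_pow_of_mem_maximalIdeal lH b ha hn j 𝔮 h𝔮
  · exact fibreForm_notMem_pow_of_exponents_lt lH b hblH hbn (hexact.resolve_left ha) ha j 𝔮 h𝔮

end Fibre

end Summit.ResolutionOfSingularities.ResolutionOfSingularities.Theorems.DeltaCutClasses
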